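import Mathlib
import Summits.NavierStokesRegularity.NavierStokesRegularity.Theses.FilamentSkeletonRss

/-!
# Route FilamentSkeletonRss · crux `CoreGluing` (stmt-NavierStokesRegularity-15401) — line `Sketch`, tool stub `stub_siblingDatumStrainModel`

Helper file (theorems only) supporting the crux item; lands with `--supports stmt-NavierStokesRegularity-15401`.

**Link (directional strain) for the sibling `C₄` skew-line datum** (stmt-NavierStokesRegularity-15400,
line `Sketch`: `P₀ = (1, 0, −10)`, `e₀ = (0, 4/5, 3/5)`, `γ/2π = 8`, `α = −5/8`). In the rotating Leray
frame the rescaled skeleton field of the datum is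
`F y = ½ y + (5/8) e₃ × y + Σ_{k=1,2,3} 8 (‖y − P_k‖² − ⟪y − P_k, e_k⟫²)⁻¹ · e_k × (y − P_k)`
(drift plus straight-line Biot–Savart induction of the three image lines `P_k + ℝ e_k`,
`P₁ = (0, 1, −10)`, `e₁ = (−4/5, 0, 3/5)`, `P₂ = (−1, 0, −10)`, `e₂ = (0, −4/5, 3/5)`,
`P₃ = (0, −1, −10)`, `e₃' = (4/5, 0, 3/5)`). Along the core line `x = P₀ + t e₀` and in the FIXED
cross direction `v = (5, −3, 4) ⊥ e₀` (`‖v‖² = 50`) the directional strain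
`d/ds ⟪F(x + s v), v⟫|_{s=0}` is the closed form `Q(t)`.

Proof (1-D, no `fderiv`; the abstract part is copied from the elliptic-datum strain model
`FilamentSkeletonRssCoreGluingEllipticDatumStrainModel`, with the Biot–Savart weight `q` made a
parameter): `g(s) = ⟪F(x + s v), v⟫ = ½⟪x, v⟫ + ½ s ‖v‖² − α⟪n × x, v⟫ + Σ_k q c_k / D_k(s)` because
`⟪n × v, v⟫ = 0` and `c_k = ⟪e_k × (x + s v − P_k), v⟫ = ⟪e_k × (x − P_k), v⟫` is constant in `s`,
while `D_k(s) = D_k + 2 β_k s + γ_k s²` is a quadratic (`strain_denom_quadratic`). Hence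
`g′(0) = ½‖v‖² − Σ_k 2 q β_k c_k / D_k²` (`strain_hasDerivAt_link`, abstract in the data); reading
off `D_k, β_k, c_k, ‖v‖²` in coordinates (`strain_datum_*`) and clearing the three positive
denominators `D₁ = 2(272t² − 320t + 425)/625`, `D₂ = 4(144t² + 625)/625`,
`D₃ = 2(272t² + 320t + 425)/625` gives the stated closed form by `ring`.
-/

set_option linter.dupNamespace false

noncomputable section

namespace Summit.NavierStokesRegularity.NavierStokesRegularity.Theorems

open Literature.Analysis.FluidPDE
open scoped RealInnerProductSpace

/-- Coordinates of the inner product on `ℝ³`. [folklore] -/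
private theorem strain_inner_three (a b : EuclideanSpace ℝ (Fin 3)) :
    inner ℝ a b = a 0 * b 0 + a 1 * b 1 + a 2 * b 2 := by
  simp [PiLp.inner_apply, Fin.sum_univ_three, mul_comm]

/-- `‖a‖² = Σ aᵢ²` on `ℝ³`. [folklore] -/
private theorem strain_norm_sq_three (a : EuclideanSpace ℝ (Fin 3)) :
    ‖a‖ ^ 2 = a 0 ^ 2 + a 1 ^ 2 + a 2 ^ 2 := by
  rw [EuclideanSpace.real_norm_sq_eq, Fin.sum_univ_three]

/-- Coordinates of the triple product `⟨a × b, c⟩` on `ℝ³`. [folklore] -/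
private theorem strain_inner_cross_three (a b c : EuclideanSpace ℝ (Fin 3)) :
    inner ℝ (cross a b) c = (a 1 * b 2 - a 2 * b 1) * c 0 + (a 2 * b 0 - a 0 * b 2) * c 1
      + (a 0 * b 1 - a 1 * b 0) * c 2 := by
  rw [strain_inner_three]
  simp [cross, cross_apply]

/-- `⟨x + s v, v⟩ = ⟨x, v⟩ + s ‖v‖²`. [folklore] -/
private theorem strain_inner_shift (x v : EuclideanSpace ℝ (Fin 3)) (s : ℝ) :
    inner ℝ (x + s • v) v = inner ℝ x v + s * ‖v‖ ^ 2 := by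
  rw [inner_add_left, real_inner_smul_left, real_inner_self_eq_norm_sq]

/-- `⟨n × (x + s v), v⟩ = ⟨n × x, v⟩` (the rotation does not strain along `v`). [folklore] -/
private theorem strain_cross_shift (n x v : EuclideanSpace ℝ (Fin 3)) (s : ℝ) :
    inner ℝ (cross n (x + s • v)) v = inner ℝ (cross n x) v := by
  rw [strain_inner_cross_three, strain_inner_cross_three]
  simp only [PiLp.add_apply, PiLp.smul_apply, smul_eq_mul]
  ring

/-- `⟨e × (x + s v − P), v⟩ = ⟨e × (x − P), v⟩`: the Biot–Savart numerator is constant along the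
probing line. [folklore] -/
private theorem strain_cross_term_const (e x v P : EuclideanSpace ℝ (Fin 3)) (s : ℝ) :
    inner ℝ (cross e (x + s • v - P)) v = inner ℝ (cross e (x - P)) v := by
  rw [strain_inner_cross_three, strain_inner_cross_three]
  simp only [PiLp.add_apply, PiLp.sub_apply, PiLp.smul_apply, smul_eq_mul]
  ring

/-- The squared distance to a line, `‖y − P‖² − ⟨y − P, e⟩²`, restricted to the probing line
`y = x + s v`, is the quadratic `D + 2βs + γs²`. [folklore] -/
private theorem strain_denom_quadratic (x v P e : EuclideanSpace ℝ (Fin 3)) (s : ℝ) :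
    ‖x + s • v - P‖ ^ 2 - (inner ℝ (x + s • v - P) e) ^ 2 =
      (‖x - P‖ ^ 2 - (inner ℝ (x - P) e) ^ 2)
        + 2 * (inner ℝ (x - P) v - inner ℝ (x - P) e * inner ℝ v e) * s
        + (‖v‖ ^ 2 - (inner ℝ v e) ^ 2) * s ^ 2 := by
  simp only [strain_norm_sq_three, strain_inner_three, PiLp.add_apply, PiLp.sub_apply,
    PiLp.smul_apply, smul_eq_mul]
  ring

/-- Linearity of `⟨·, v⟩` on the five summands of the model field. [folklore] -/
private theorem strain_inner_model_expand (y w₀ w₁ w₂ w₃ v : EuclideanSpace ℝ (Fin 3))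
    (h α r₁ r₂ r₃ : ℝ) :
    inner ℝ (h • y - α • w₀ + r₁ • w₁ + r₂ • w₂ + r₃ • w₃) v
      = h * inner ℝ y v - α * inner ℝ w₀ v + r₁ * inner ℝ w₁ v + r₂ * inner ℝ w₂ v
        + r₃ * inner ℝ w₃ v := by
  simp only [inner_add_left, inner_sub_left, real_inner_smul_left]

/-- One weighted Lorentzian along the probing line:
`d/ds [q c / (D + 2βs + γs²)]|₀ = −2qβc/D²`. [folklore] -/
private theorem strain_hasDerivAt_lorentz (q D β γ c : ℝ) (hD : D ≠ 0) :
    HasDerivAt (fun s : ℝ => q / (D + 2 * β * s + γ * s ^ 2) * c)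
      (-(q * c * (2 * β) / D ^ 2)) 0 := by
  have hq : HasDerivAt (fun s : ℝ => D + 2 * β * s + γ * s ^ 2) (2 * β) 0 := by
    have h1 : HasDerivAt (fun s : ℝ => 2 * β * s) (2 * β) 0 := by
      simpa using (hasDerivAt_id (0 : ℝ)).const_mul (2 * β)
    have h2 : HasDerivAt (fun s : ℝ => γ * s ^ 2) 0 0 := by
      simpa using (hasDerivAt_pow 2 (0 : ℝ)).const_mul γ
    simpa using (h1.const_add D).fun_add h2
  have h := ((hasDerivAt_const (0 : ℝ) q).div hq (by simpa using hD)).mul_const c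
  refine h.congr_deriv ?_
  simp only [mul_zero, add_zero, zero_mul, ne_eq, OfNat.ofNat_ne_zero, not_false_eq_true,
    zero_pow, zero_sub]
  ring

/-- The scalar model `½(K + sL) − M + Σ_k q c_k/(D_k + 2β_k s + γ_k s²)` along the probing line has
derivative `½ L − Σ_k 2 q β_k c_k / D_k²` at `s = 0`. [folklore] -/
private theorem strain_hasDerivAt_scalar (q K L M D₁ β₁ γ₁ c₁ D₂ β₂ γ₂ c₂ D₃ β₃ γ₃ c₃ : ℝ)
    (h₁ : D₁ ≠ 0) (h₂ : D₂ ≠ 0) (h₃ : D₃ ≠ 0) :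
    HasDerivAt (fun s : ℝ => (1 / 2 : ℝ) * (K + s * L) - M
        + q / (D₁ + 2 * β₁ * s + γ₁ * s ^ 2) * c₁
        + q / (D₂ + 2 * β₂ * s + γ₂ * s ^ 2) * c₂
        + q / (D₃ + 2 * β₃ * s + γ₃ * s ^ 2) * c₃)
      ((1 / 2 : ℝ) * L - q * c₁ * (2 * β₁) / D₁ ^ 2 - q * c₂ * (2 * β₂) / D₂ ^ 2
        - q * c₃ * (2 * β₃) / D₃ ^ 2) 0 := by
  have h0 : HasDerivAt (fun s : ℝ => (1 / 2 : ℝ) * (K + s * L) - M) ((1 / 2 : ℝ) * L) 0 := by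
    have h := ((((hasDerivAt_id (0 : ℝ)).mul_const L).const_add K).const_mul (1 / 2 : ℝ)).sub_const M
    simpa using h
  exact (((h0.fun_add (strain_hasDerivAt_lorentz q D₁ β₁ γ₁ c₁ h₁)).fun_add
    (strain_hasDerivAt_lorentz q D₂ β₂ γ₂ c₂ h₂)).fun_add
    (strain_hasDerivAt_lorentz q D₃ β₃ γ₃ c₃ h₃)).congr_deriv (by ring)

/-- **Abstract 1-D link.** For the model field
`F y = ½ y − α n × y + Σ_k q (‖y − P_k‖² − ⟪y − P_k, e_k⟫²)⁻¹ · e_k × (y − P_k)` and any point `x` off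
the three lines, `s ↦ ⟪F(x + s v), v⟫` has derivative `½‖v‖² − Σ_k q c_k · 2β_k / D_k²` at `s = 0`,
where `D_k = ‖x − P_k‖² − ⟪x − P_k, e_k⟫²`, `β_k = ⟪x − P_k, v⟫ − ⟪x − P_k, e_k⟫⟪v, e_k⟫`,
`c_k = ⟪e_k × (x − P_k), v⟫`. [folklore] -/
private theorem strain_hasDerivAt_link (x v n P₁ e₁ P₂ e₂ P₃ e₃ : EuclideanSpace ℝ (Fin 3))
    (α q : ℝ)
    (h₁ : ‖x - P₁‖ ^ 2 - (inner ℝ (x - P₁) e₁) ^ 2 ≠ 0)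
    (h₂ : ‖x - P₂‖ ^ 2 - (inner ℝ (x - P₂) e₂) ^ 2 ≠ 0)
    (h₃ : ‖x - P₃‖ ^ 2 - (inner ℝ (x - P₃) e₃) ^ 2 ≠ 0) :
    HasDerivAt (fun s : ℝ => inner ℝ ((1 / 2 : ℝ) • (x + s • v) - α • cross n (x + s • v)
        + (q / (‖(x + s • v) - P₁‖ ^ 2 - (inner ℝ ((x + s • v) - P₁) e₁) ^ 2)) •
            cross e₁ ((x + s • v) - P₁)
        + (q / (‖(x + s • v) - P₂‖ ^ 2 - (inner ℝ ((x + s • v) - P₂) e₂) ^ 2)) •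
            cross e₂ ((x + s • v) - P₂)
        + (q / (‖(x + s • v) - P₃‖ ^ 2 - (inner ℝ ((x + s • v) - P₃) e₃) ^ 2)) •
            cross e₃ ((x + s • v) - P₃)) v)
      ((1 / 2 : ℝ) * ‖v‖ ^ 2
        - q * inner ℝ (cross e₁ (x - P₁)) v
            * (2 * (inner ℝ (x - P₁) v - inner ℝ (x - P₁) e₁ * inner ℝ v e₁))
            / (‖x - P₁‖ ^ 2 - (inner ℝ (x - P₁) e₁) ^ 2) ^ 2
        - q * inner ℝ (cross e₂ (x - P₂)) v
            * (2 * (inner ℝ (x - P₂) v - inner ℝ (x - P₂) e₂ * inner ℝ v e₂))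
            / (‖x - P₂‖ ^ 2 - (inner ℝ (x - P₂) e₂) ^ 2) ^ 2
        - q * inner ℝ (cross e₃ (x - P₃)) v
            * (2 * (inner ℝ (x - P₃) v - inner ℝ (x - P₃) e₃ * inner ℝ v e₃))
            / (‖x - P₃‖ ^ 2 - (inner ℝ (x - P₃) e₃) ^ 2) ^ 2) 0 := by
  refine (strain_hasDerivAt_scalar q (inner ℝ x v) (‖v‖ ^ 2) (α * inner ℝ (cross n x) v)
    (‖x - P₁‖ ^ 2 - (inner ℝ (x - P₁) e₁) ^ 2)
    (inner ℝ (x - P₁) v - inner ℝ (x - P₁) e₁ * inner ℝ v e₁) (‖v‖ ^ 2 - (inner ℝ v e₁) ^ 2)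
    (inner ℝ (cross e₁ (x - P₁)) v)
    (‖x - P₂‖ ^ 2 - (inner ℝ (x - P₂) e₂) ^ 2)
    (inner ℝ (x - P₂) v - inner ℝ (x - P₂) e₂ * inner ℝ v e₂) (‖v‖ ^ 2 - (inner ℝ v e₂) ^ 2)
    (inner ℝ (cross e₂ (x - P₂)) v)
    (‖x - P₃‖ ^ 2 - (inner ℝ (x - P₃) e₃) ^ 2)
    (inner ℝ (x - P₃) v - inner ℝ (x - P₃) e₃ * inner ℝ v e₃) (‖v‖ ^ 2 - (inner ℝ v e₃) ^ 2)
    (inner ℝ (cross e₃ (x - P₃)) v) h₁ h₂ h₃).congr_of_eventuallyEq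
    (Filter.Eventually.of_forall fun s => ?_)
  beta_reduce
  rw [strain_inner_model_expand, strain_inner_shift, strain_cross_shift,
    strain_cross_term_const, strain_cross_term_const, strain_cross_term_const,
    strain_denom_quadratic, strain_denom_quadratic, strain_denom_quadratic]

/-- Line `1` of the sibling datum seen from the probing line: `D₁ = 2(272t² − 320t + 425)/625`,
`β₁ = 72t/125 + 168/25`, `c₁ = −32t/5 + 22/5`. [folklore] -/
private theorem strain_sibling_datum_one (t : ℝ) (x : EuclideanSpace ℝ (Fin 3))
    (hx : x = !₂[(1 : ℝ), (0 : ℝ), ((-10) : ℝ)] + t • !₂[(0 : ℝ), (4 / 5 : ℝ), (3 / 5 : ℝ)]) :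
    ‖x - !₂[(0 : ℝ), (1 : ℝ), ((-10) : ℝ)]‖ ^ 2
        - (inner ℝ (x - !₂[(0 : ℝ), (1 : ℝ), ((-10) : ℝ)])
            !₂[(-(4 / 5 : ℝ)), (0 : ℝ), (3 / 5 : ℝ)]) ^ 2
          = 2 * (272 * t ^ 2 - 320 * t + 425) / 625 ∧
      inner ℝ (x - !₂[(0 : ℝ), (1 : ℝ), ((-10) : ℝ)]) !₂[(5 : ℝ), ((-3) : ℝ), (4 : ℝ)]
        - inner ℝ (x - !₂[(0 : ℝ), (1 : ℝ), ((-10) : ℝ)])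
            !₂[(-(4 / 5 : ℝ)), (0 : ℝ), (3 / 5 : ℝ)]
          * inner ℝ !₂[(5 : ℝ), ((-3) : ℝ), (4 : ℝ)] !₂[(-(4 / 5 : ℝ)), (0 : ℝ), (3 / 5 : ℝ)]
          = 72 / 125 * t + 168 / 25 ∧
      inner ℝ (cross !₂[(-(4 / 5 : ℝ)), (0 : ℝ), (3 / 5 : ℝ)]
          (x - !₂[(0 : ℝ), (1 : ℝ), ((-10) : ℝ)])) !₂[(5 : ℝ), ((-3) : ℝ), (4 : ℝ)]
          = -(32 / 5) * t + 22 / 5 := by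
  subst hx
  rw [strain_inner_cross_three]
  simp only [strain_norm_sq_three, strain_inner_three]
  simp
  refine ⟨?_, ?_, ?_⟩ <;> ring

/-- Line `2` of the sibling datum seen from the probing line: `D₂ = 4(144t² + 625)/625`,
`β₂ = 168t/125 + 10`, `c₂ = −24t/5 + 14/5`. [folklore] -/
private theorem strain_sibling_datum_two (t : ℝ) (x : EuclideanSpace ℝ (Fin 3))
    (hx : x = !₂[(1 : ℝ), (0 : ℝ), ((-10) : ℝ)] + t • !₂[(0 : ℝ), (4 / 5 : ℝ), (3 / 5 : ℝ)]) :
    ‖x - !₂[((-1) : ℝ), (0 : ℝ), ((-10) : ℝ)]‖ ^ 2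
        - (inner ℝ (x - !₂[((-1) : ℝ), (0 : ℝ), ((-10) : ℝ)])
            !₂[(0 : ℝ), (-(4 / 5 : ℝ)), (3 / 5 : ℝ)]) ^ 2
          = 4 * (144 * t ^ 2 + 625) / 625 ∧
      inner ℝ (x - !₂[((-1) : ℝ), (0 : ℝ), ((-10) : ℝ)]) !₂[(5 : ℝ), ((-3) : ℝ), (4 : ℝ)]
        - inner ℝ (x - !₂[((-1) : ℝ), (0 : ℝ), ((-10) : ℝ)])
            !₂[(0 : ℝ), (-(4 / 5 : ℝ)), (3 / 5 : ℝ)]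
          * inner ℝ !₂[(5 : ℝ), ((-3) : ℝ), (4 : ℝ)] !₂[(0 : ℝ), (-(4 / 5 : ℝ)), (3 / 5 : ℝ)]
          = 168 / 125 * t + 10 ∧
      inner ℝ (cross !₂[(0 : ℝ), (-(4 / 5 : ℝ)), (3 / 5 : ℝ)]
          (x - !₂[((-1) : ℝ), (0 : ℝ), ((-10) : ℝ)])) !₂[(5 : ℝ), ((-3) : ℝ), (4 : ℝ)]
          = -(24 / 5) * t + 14 / 5 := by
  subst hx
  rw [strain_inner_cross_three]
  simp only [strain_norm_sq_three, strain_inner_three]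
  simp
  refine ⟨?_, ?_, ?_⟩ <;> ring

/-- Line `3` of the sibling datum seen from the probing line: `D₃ = 2(272t² + 320t + 425)/625`,
`β₃ = −288t/125 − 78/25`, `c₃ = 8t/5 − 8/5`. [folklore] -/
private theorem strain_sibling_datum_three (t : ℝ) (x : EuclideanSpace ℝ (Fin 3))
    (hx : x = !₂[(1 : ℝ), (0 : ℝ), ((-10) : ℝ)] + t • !₂[(0 : ℝ), (4 / 5 : ℝ), (3 / 5 : ℝ)]) :
    ‖x - !₂[(0 : ℝ), ((-1) : ℝ), ((-10) : ℝ)]‖ ^ 2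
        - (inner ℝ (x - !₂[(0 : ℝ), ((-1) : ℝ), ((-10) : ℝ)])
            !₂[(4 / 5 : ℝ), (0 : ℝ), (3 / 5 : ℝ)]) ^ 2
          = 2 * (272 * t ^ 2 + 320 * t + 425) / 625 ∧
      inner ℝ (x - !₂[(0 : ℝ), ((-1) : ℝ), ((-10) : ℝ)]) !₂[(5 : ℝ), ((-3) : ℝ), (4 : ℝ)]
        - inner ℝ (x - !₂[(0 : ℝ), ((-1) : ℝ), ((-10) : ℝ)])
            !₂[(4 / 5 : ℝ), (0 : ℝ), (3 / 5 : ℝ)]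
          * inner ℝ !₂[(5 : ℝ), ((-3) : ℝ), (4 : ℝ)] !₂[(4 / 5 : ℝ), (0 : ℝ), (3 / 5 : ℝ)]
          = -(288 / 125) * t - 78 / 25 ∧
      inner ℝ (cross !₂[(4 / 5 : ℝ), (0 : ℝ), (3 / 5 : ℝ)]
          (x - !₂[(0 : ℝ), ((-1) : ℝ), ((-10) : ℝ)])) !₂[(5 : ℝ), ((-3) : ℝ), (4 : ℝ)]
          = 8 / 5 * t - 8 / 5 := by
  subst hx
  rw [strain_inner_cross_three]
  simp only [strain_norm_sq_three, strain_inner_three]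
  simp
  refine ⟨?_, ?_, ?_⟩ <;> ring

/-- The fixed cross direction has `‖(5, −3, 4)‖² = 50`. [folklore] -/
private theorem strain_sibling_datum_norm_sq :
    ‖(!₂[(5 : ℝ), ((-3) : ℝ), (4 : ℝ)] : EuclideanSpace ℝ (Fin 3))‖ ^ 2 = 50 := by
  rw [strain_norm_sq_three]
  simp
  norm_num

/-- **Link (sibling datum, expanding direction).** For the sibling crux's C₄ datum (stmt-NavierStokesRegularity-15400,
line `Sketch`: `P₀ = (1,0,−10)`, `e₀ = (0,4/5,3/5)`, `γ/2π = 8`, `α = −5/8`), the directional strain of the inner skeleton field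
(Leray–rotation drift `½x + (5/8) e₃×x` plus the straight-line Biot–Savart induction of the three image lines) at the point
`x = P₀ + t e₀` in the FIXED cross direction `v = (5, −3, 4) ⊥ e₀` (`‖v‖² = 50`), `d/ds ⟪v, W̃(x + s v)⟫|₀`, is the closed form `Q`.
[folklore] -/
theorem stub_siblingDatumStrainModel :
    ∀ (Q : ℝ → ℝ), (∀ t, Q t = (25 : ℝ) + ((5760000 : ℝ) * t ^ 2 + (63240000 : ℝ) * t - 46200000) / (272 * t ^ 2 - 320 * t + 425) ^ 2 + ((2520000 : ℝ) * t ^ 2 + (17280000 : ℝ) * t - 10937500) / (144 * t ^ 2 + 625) ^ 2 + ((5760000 : ℝ) * t ^ 2 + (2040000 : ℝ) * t - 7800000) / (272 * t ^ 2 + 320 * t + 425) ^ 2) →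
      ∀ (t : ℝ) (x : EuclideanSpace ℝ (Fin 3)), x = !₂[(1 : ℝ), (0 : ℝ), ((-10) : ℝ)] + t • !₂[(0 : ℝ), (4 / 5 : ℝ), (3 / 5 : ℝ)] →
        HasDerivAt (fun s : ℝ => inner ℝ ((1 / 2 : ℝ) • (x + s • !₂[(5 : ℝ), ((-3) : ℝ), (4 : ℝ)]) - (-(5 / 8 : ℝ)) • Literature.Analysis.FluidPDE.cross (EuclideanSpace.single (2 : Fin 3) (1 : ℝ)) (x + s • !₂[(5 : ℝ), ((-3) : ℝ), (4 : ℝ)]) + ((8 : ℝ) / (‖(x + s • !₂[(5 : ℝ), ((-3) : ℝ), (4 : ℝ)]) - !₂[(0 : ℝ), (1 : ℝ), ((-10) : ℝ)]‖ ^ 2 - (inner ℝ ((x + s • !₂[(5 : ℝ), ((-3) : ℝ), (4 : ℝ)]) - !₂[(0 : ℝ), (1 : ℝ), ((-10) : ℝ)]) !₂[(-(4 / 5 : ℝ)), (0 : ℝ), (3 / 5 : ℝ)]) ^ 2)) • Literature.Analysis.FluidPDE.cross !₂[(-(4 / 5 : ℝ)), (0 : ℝ), (3 / 5 : ℝ)]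 ((x + s • !₂[(5 : ℝ), ((-3) : ℝ), (4 : ℝ)]) - !₂[(0 : ℝ), (1 : ℝ), ((-10) : ℝ)]) + ((8 : ℝ) / (‖(x + s • !₂[(5 : ℝ), ((-3) : ℝ), (4 : ℝ)]) - !₂[((-1) : ℝ), (0 : ℝ), ((-10) : ℝ)]‖ ^ 2 - (inner ℝ ((x + s • !₂[(5 : ℝ), ((-3) : ℝ), (4 : ℝ)]) - !₂[((-1) : ℝ), (0 : ℝ), ((-10) : ℝ)]) !₂[(0 : ℝ), (-(4 / 5 : ℝ)), (3 / 5 : ℝ)]) ^ 2)) • Literature.Analysis.FluidPDE.cross !₂[(0 : ℝ), (-(4 / 5 : ℝ)), (3 / 5 : ℝ)] ((x + s • !₂[(5 : ℝ), ((-3) : ℝ), (4 : ℝ)]) - !₂[((-1) : ℝ), (0 : ℝ), ((-10) : ℝ)]) + ((8 : ℝ) / (‖(x + s • !₂[(5 : ℝ), ((-3) : ℝ), (4 : ℝ)]) - !₂[(0 : ℝ), ((-1) : ℝ), ((-10) : ℝ)]‖ ^ 2 - (inner ℝ ((x + s • !₂[(5 : ℝ), ((-3) : ℝ), (4 : ℝ)])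 - !₂[(0 : ℝ), ((-1) : ℝ), ((-10) : ℝ)]) !₂[(4 / 5 : ℝ), (0 : ℝ), (3 / 5 : ℝ)]) ^ 2)) • Literature.Analysis.FluidPDE.cross !₂[(4 / 5 : ℝ), (0 : ℝ), (3 / 5 : ℝ)] ((x + s • !₂[(5 : ℝ), ((-3) : ℝ), (4 : ℝ)]) - !₂[(0 : ℝ), ((-1) : ℝ), ((-10) : ℝ)])) !₂[(5 : ℝ), ((-3) : ℝ), (4 : ℝ)]) (Q t) 0 := by
  intro Q hQ t x hx
  obtain ⟨hD₁, hβ₁, hc₁⟩ := strain_sibling_datum_one t x hx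
  obtain ⟨hD₂, hβ₂, hc₂⟩ := strain_sibling_datum_two t x hx
  obtain ⟨hD₃, hβ₃, hc₃⟩ := strain_sibling_datum_three t x hx
  have hvv := strain_sibling_datum_norm_sq
  have hp₁ : 0 < 272 * t ^ 2 - 320 * t + 425 := by nlinarith [sq_nonneg (17 * t - 10)]
  have hp₂ : 0 < 144 * t ^ 2 + 625 := by positivity
  have hp₃ : 0 < 272 * t ^ 2 + 320 * t + 425 := by nlinarith [sq_nonneg (17 * t + 10)]
  refine (strain_hasDerivAt_link x _ _ _ _ _ _ _ _ (-(5 / 8 : ℝ)) 8 ?_ ?_ ?_).congr_deriv ?_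
  · rw [hD₁]; exact div_ne_zero (mul_ne_zero two_ne_zero hp₁.ne') (by norm_num)
  · rw [hD₂]; positivity
  · rw [hD₃]; exact div_ne_zero (mul_ne_zero two_ne_zero hp₃.ne') (by norm_num)
  · rw [hQ, hD₁, hD₂, hD₃, hβ₁, hβ₂, hβ₃, hc₁, hc₂, hc₃, hvv]
    have hq₁ := hp₁.ne'
    have hq₂ := hp₂.ne'
    have hq₃ := hp₃.ne'
    field_simp
    ring

end Summit.NavierStokesRegularity.NavierStokesRegularity.Theorems
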